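import Literature.AlgebraicGeometry.Motives.FaltingsECTateFiniteHoldsProofs
import Literature.AlgebraicGeometry.Motives.FaltingsECOfAbelianVarietyLatticeProofs
import Literature.AlgebraicGeometry.Motives.AbelianVarietyProduct
import Literature.NumberTheory.EllipticCurves.IsogenyDualFiniteFieldProofs
import Literature.NumberTheory.EllipticCurves.TateModuleFreeProofs
import Literature.NumberTheory.EllipticCurves.AbelianVarietyBridgeProofs
import Literature.AlgebraicGeometry.Motives.TateAbelianFiniteLatticeProofs
import Literature.AlgebraicGeometry.Motives.TateAbelianLatticeOfFinitenessProofs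
import HarnessLib

/-!
# Tate's theorem (`Hom` form) for two elliptic curves over a finite field from the named facts of the theory of abelian varieties

Sibling proof file (D-0014; theorems only) of `Literature.AlgebraicGeometry.Motives.FaltingsEC`
for its named fact

* `Literature.AlgebraicGeometry.Motives.mem_span_range_tateModule_map_of_equivariant_of_finite W W' ℓ`
  — **Tate, Invent. Math. 2 (1966), Main Theorem, for two elliptic curves `E, E'` over a finite
  field `k` and a prime `ℓ ≠ char k`**: every `ℤ_ℓ`-linear `Γ_k`-equivariant `T_ℓ E → T_ℓ E'`
  lies in the `ℤ_ℓ`-span of the `T_ℓ φ`, `φ : E → E'` an isogeny over `k` (surjectivity of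
  `Hom_k(E, E') ⊗ ℤ_ℓ → Hom_{Γ_k}(T_ℓ E, T_ℓ E')`; Silverman, *AEC*, Thm. III.7.7(a)).

It records the top of the fact's dependency graph in the tree. By
`FaltingsECTateFiniteHoldsProofs` / `FaltingsECTateFiniteCasesProofs` the fact is proved for
`E' = E` and for isogenous pairs, and is equivalent to Tate's isogeny theorem
`isIsogenous_of_finite_iff_exists_tateModule_hom_ne_zero W W' ℓ` (Theorem 1 (b) of the paper),
whose decomposition along Tate's printed proof (the abelian surface `E × E'`) is
`isIsogenous_of_finite_iff_exists_tateModule_hom_ne_zero_of_named_facts`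
(`FaltingsECOfAbelianVarietyLatticeProofs`) with six named-fact leaves. One of them, the reverse
isogeny `Isogeny.nonempty_symm` for `(E', E)`, is now a theorem over finite fields
(`WeierstrassCurve.Isogeny.nonempty_symm_of_finite`,
`Literature.NumberTheory.EllipticCurves.IsogenyDualFiniteFieldProofs`: Silverman's Cor. III.4.11
from the inclusion of function fields applied to `σ_q^s ∘ [#ker φ]`), leaving five, all statements of the general theory of abelian varieties over `K` plus the
identification of a smooth Weierstrass cubic with a one-dimensional abelian variety:

1. `WeierstrassCurve.nonempty_abelianVarietyBridge_symm W W'` (*AEC* III.3.1(c), III.3.6,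
   III.4.8–4.9: `E, E'` are abelian varieties of dimension one whose homomorphisms are the
   isogenies);
2. `AbelianVariety.hasBinaryBiproduct A A'` for all `A, A'` (products);
3. `AbelianVariety.finite_isoClasses_of_finite K g` for all `g` (Milne 1986, Cor. 18.9:
   finitely many `k`-isomorphism classes in each dimension);
4. `AbelianVariety.exists_quotient_isogeny P ℓ` for all `P` (quotients by finite `Γ_k`-stable
   `ℓ`-power subgroups; Kieffer 2024, Prop. 1.1.10–1.1.13);
5. `AbelianVariety.natCard_torsionPoints_of_isAlgClosed` for all `P` (Mumford §6:
   `#P[n](K̄) = n^{2g}` for `n` invertible).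

* `Literature.AlgebraicGeometry.Motives.isIsogenous_of_finite_iff_exists_tateModule_hom_ne_zero_of_named_facts'`:
  the isogeny theorem from 1–5;
* `Literature.AlgebraicGeometry.Motives.mem_span_range_tateModule_map_of_equivariant_of_finite_of_named_facts`:
  the `Hom` form of the Main Theorem from 1–5. With discharges of 1–5 this is its `_holds` theorem.

### The frontier with three named facts (second section)

Two of the five leaves are not needed as hypotheses. Leaf 2 is a theorem of the tree
(`AbelianVariety.hasBinaryBiproduct_inst`, `Motives/AbelianVarietyProduct`: `AbelianVariety K` is
preadditive with binary products). Leaf 5 enters Tate's lattice argument only through "`T_ℓ(E × E')`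
is a free `ℤ_ℓ`-module of finite rank", and for the biproduct `b.pt` of the two bridged abelian
varieties this follows from the elliptic curves themselves: `T_ℓ(b.pt) ≅ T_ℓ A × T_ℓ A'`
(additivity and functoriality of `T_ℓ`, `exists_tateModule_linearEquiv_prod_of_bicone`),
`T_ℓ A ≅ T_ℓ E`, `T_ℓ A' ≅ T_ℓ E'` along the bridge identifications of geometric points
(`module_free_tateModule_of_addEquiv`, `module_finite_tateModule_of_addEquiv`), and `T_ℓ E` is
free and finitely generated for every elliptic curve and every prime (Silverman, *AEC*,
Prop. III.7.1, the tree's `WeierstrassCurve.module_free_tateModule_holds`,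
`module_finite_tateModule_holds`). Hence

* `Literature.AlgebraicGeometry.Motives.isIsogenous_of_finite_iff_exists_tateModule_hom_ne_zero_of_bridge_of_finite_of_quotient`:
  Tate's isogeny theorem for elliptic curves over a finite field from the three named facts
  1 (bridge), 3 (finiteness of isomorphism classes over a finite field) and 4 (quotient
  isogenies) only;
* `Literature.AlgebraicGeometry.Motives.mem_span_range_tateModule_map_of_equivariant_of_finite_of_bridge_of_finite_of_quotient`:
  the `Hom` form of Tate's Main Theorem for two elliptic curves from the same three facts — the
  current shape of the eventual `mem_span_range_tateModule_map_of_equivariant_of_finite_holds`.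

### The frontier with two named facts (third section)

Leaf 1, the bridge, is now a theorem of the tree:
`WeierstrassCurve.nonempty_abelianVarietyBridge_symm_holds`
(`Literature.NumberTheory.EllipticCurves.AbelianVarietyBridgeProofs`: the plane cubic
`E_W ⊂ ℙ²_K` with its addition and negation morphisms is an abelian-variety model of `W`
(`AbelianVarietyModelOfAddHom`), and non-zero homomorphisms of models are isogenies on points
(`AbelianVarietyModelIsogeny`); Silverman, *AEC* III.3.1(c), III.3.6, III.4.8–4.9). Feeding it in:

* `Literature.AlgebraicGeometry.Motives.isIsogenous_of_finite_iff_exists_tateModule_hom_ne_zero_of_finite_of_quotient`: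
  Tate's isogeny theorem for elliptic curves over a finite field from the two named facts
  3 (finiteness of isomorphism classes of abelian varieties of each dimension over a finite
  field, Milne 1986 Cor. 18.9) and 4 (quotient isogenies, Mumford §7 Thm. 4) only;
* `Literature.AlgebraicGeometry.Motives.mem_span_range_tateModule_map_of_equivariant_of_finite_of_finite_of_quotient`:
  the `Hom` form of Tate's Main Theorem for two elliptic curves from the same two facts — the
  current shape of the eventual `mem_span_range_tateModule_map_of_equivariant_of_finite_holds`
  (`… W W' ℓ (fun g ↦ finite_isoClasses_of_finite_holds K g) (fun P ↦ exists_quotient_isogeny_holds P ℓ)`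
  once the abelian-variety library proves the two; both are the inputs of Tate's printed proof for
  the abelian surface `E × E'`, Tate 1966 §2–§3; the second has since been discharged, see the
  fourth section).

### The frontier with one named fact (fourth section)

Leaf 4, the quotient fact, is now a theorem of the tree:
`AbelianVariety.exists_quotient_isogeny_holds`
(`Literature.AlgebraicGeometry.Motives.TateAbelianFiniteLatticeProofs`: the quotient
`P/S := (P_L)/(S ⋊ Gal(L/K))` of `P` by a finite `Γ_K`-stable subgroup `S ⊆ P(K̄)`, built in
`AbelianVarietyQuotientGeomPoints` as a relative `Spec` of invariants with the group law descended
along the flat surjection `P → P/S` (Mumford §7 Thm. 4, §12 Thm. 1), and the factorisation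
`[ℓⁿ] = f ∘ h`, `h ∘ f = [ℓⁿ]` of Kieffer 2024, Prop. 1.1.12–1.1.13). Feeding it in:

* `Literature.AlgebraicGeometry.Motives.isIsogenous_of_finite_iff_exists_tateModule_hom_ne_zero_of_finite_isoClasses`:
  Tate's isogeny theorem for elliptic curves over a finite field from the single named fact 3,
  `AbelianVariety.finite_isoClasses_of_finite K g` for all `g` (finitely many `K`-isomorphism
  classes of abelian varieties of each dimension over the finite field `K`; Milne 1986, Cor. 18.9 —
  in Tate's text the finiteness hypothesis of the proof of the Main Theorem, §2, verified for
  finite `k` from the finiteness of polarised abelian varieties of given degree and dimension);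
* `Literature.AlgebraicGeometry.Motives.mem_span_range_tateModule_map_of_equivariant_of_finite_of_finite_isoClasses`:
  the `Hom` form of Tate's Main Theorem for two elliptic curves from the same single fact — the
  current shape of the eventual `mem_span_range_tateModule_map_of_equivariant_of_finite_holds`
  (`… W W' ℓ (fun g ↦ finite_isoClasses_of_finite_holds K g)` once the abelian-variety library
  proves Milne's Cor. 18.9; it has no discharge in the tree);
* `Literature.AlgebraicGeometry.Motives.isIsogenous_of_finite_iff_exists_tateModule_hom_ne_zero_of_exists_infinite_iso`,
  `Literature.AlgebraicGeometry.Motives.mem_span_range_tateModule_map_of_equivariant_of_finite_of_exists_infinite_iso`: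
  the same two statements from the weaker hypothesis actually consumed by Tate's lattice argument,
  **(∞-iso)**: in every sequence of abelian varieties over the finite field `K` isogenous to a
  given one, infinitely many terms are mutually isomorphic — finiteness of `K`-isomorphism classes
  *within each isogeny class* (Tate 1966, §2, the finiteness hypothesis as used in the proof of
  the Main Theorem; Milne, *Abelian Varieties* (2008), Ch. IV, Lemma 2.4), through the tree's
  perfect-field lattice lemma `tateSubspaceRealization_of_exists_infinite_iso`
  (`TateAbelianLatticeOfFinitenessProofs`). Over a finite field (∞-iso) is the pigeonhole
  consequence of fact 3 (`AbelianVariety.exists_infinite_iso_of_finite_isoClasses_of_finite_of_isIsogenous`,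
  `TateAbelianFiniteCubeProofs`).

## References

* [Tate1966Endomorphisms] J. Tate, *Endomorphisms of abelian varieties over finite fields*,
  Invent. Math. 2 (1966), 134–144: Main Theorem; §2; §3 Theorem 1.
* [SilvermanAEC2009] J. H. Silverman, *The Arithmetic of Elliptic Curves*, 2nd ed., GTM 106:
  Thm. III.7.7(a), Prop. III.7.1, Cor. II.2.12, Thm. III.6.1.
* [Milne1986AbelianVarieties] J. S. Milne, *Abelian Varieties* (Cornell–Silverman 1986),
  Cor. 18.9 (p. 144: from Zarhin's trick 16.12, the finiteness of principally polarised abelian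
  varieties of given dimension over a finite field 14.1, and the finiteness of direct factors 18.7).
* [MilneAV2008] J. S. Milne, *Abelian Varieties*, course notes v2.00 (2008), Ch. IV, Lemma 2.4 and
  Thm. 2.5.
* [Kieffer2024IsogenyGraphs] J. Kieffer, *Isogeny graphs of abelian varieties over finite
  fields* (2024), §1.1–1.2.
* [MumfordAV1970] D. Mumford, *Abelian Varieties* (1970), §6, §7 Thm. 4, §12 Thm. 1.
-/

noncomputable section

universe u

namespace Literature.AlgebraicGeometry.Motives

open WeierstrassCurve AbelianVariety CategoryTheory

variable {K : Type u} [Field K] (W W' : WeierstrassCurve K) (ℓ : ℕ) [Fact ℓ.Prime]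

/-- **Tate's isogeny theorem for elliptic curves over a finite field from five named facts of
the theory of abelian varieties** (the tree's
`isIsogenous_of_finite_iff_exists_tateModule_hom_ne_zero_of_facts` with its sixth hypothesis, the
reverse isogeny for `(E', E)`, discharged over the finite field by
`WeierstrassCurve.Isogeny.nonempty_symm_holds_of_finite W' W`): granted symmetric bridge data identifying
`E, E'` with abelian varieties (`hbridge`), biproducts (`hprod`), finiteness of isomorphism
classes over finite fields (`hfin`), quotient isogenies (`hquot`) and `#P[n](K̄) = n^{2g}`
(`hcard`), the named fact `isIsogenous_of_finite_iff_exists_tateModule_hom_ne_zero W W' ℓ` holds: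
for `k` finite and `ℓ ≠ char k`, `E ~_k E'` iff there is a non-zero `Γ_k`-equivariant
`ℤ_ℓ`-linear `T_ℓ E → T_ℓ E'`. Tate, Invent. Math. 2 (1966), Theorem 1 (b); Silverman, *AEC*,
Thm. III.7.7(a). [cite: Tate1966Endomorphisms, Thm. 1(b)] -/
theorem isIsogenous_of_finite_iff_exists_tateModule_hom_ne_zero_of_named_facts'
    (hbridge : nonempty_abelianVarietyBridge_symm W W')
    (hprod : ∀ A A' : AbelianVariety K, hasBinaryBiproduct A A')
    (hfin : ∀ g : ℕ, finite_isoClasses_of_finite K g)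
    (hquot : ∀ P : AbelianVariety K, exists_quotient_isogeny P ℓ)
    (hcard : ∀ P : AbelianVariety K, P.natCard_torsionPoints_of_isAlgClosed (AlgebraicClosure K)) :
    isIsogenous_of_finite_iff_exists_tateModule_hom_ne_zero W W' ℓ := by
  intro _ _ _ hℓ
  exact isIsogenous_of_finite_iff_exists_tateModule_hom_ne_zero_of_facts W W' ℓ
    (fun {_ _ _} ↦ hbridge) hprod hfin hquot hcard (Isogeny.nonempty_symm_holds_of_finite W' W) hℓ

/-- **Tate's Main Theorem (`Hom` form) for two elliptic curves over a finite field from five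
named facts of the theory of abelian varieties.** Granted the five facts of
`isIsogenous_of_finite_iff_exists_tateModule_hom_ne_zero_of_named_facts'` (bridge, biproducts,
finiteness of isomorphism classes, quotient isogenies, `#P[n](K̄) = n^{2g}`), the named fact
`mem_span_range_tateModule_map_of_equivariant_of_finite W W' ℓ` holds: for `E, E'` elliptic over a
finite field `k` and a prime `ℓ ≠ char k`, every `ℤ_ℓ`-linear `Γ_k`-equivariant `T_ℓ E → T_ℓ E'`
is in the `ℤ_ℓ`-span of the `T_ℓ φ`, `φ : E → E'` an isogeny over `k`. The isogeny theorem
supplies one isogeny `E → E'` when a non-zero equivariant map exists, and the case of isogenous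
curves is the tree's theorem `mem_span_range_tateModule_map_of_equivariant_of_finite_of_isIsogenous`
(Tate's §1 Lemma 1 and §2 for `End_k(E)`, quotient isogenies of elliptic curves, *AEC*
Cor. III.4.11 — all proved). Tate, Invent. Math. 2 (1966), Main Theorem; Silverman, *AEC*,
Thm. III.7.7(a). [cite: Tate1966Endomorphisms, Main Theorem] -/
theorem mem_span_range_tateModule_map_of_equivariant_of_finite_of_named_facts
    (hbridge : nonempty_abelianVarietyBridge_symm W W')
    (hprod : ∀ A A' : AbelianVariety K, hasBinaryBiproduct A A')
    (hfin : ∀ g : ℕ, finite_isoClasses_of_finite K g)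
    (hquot : ∀ P : AbelianVariety K, exists_quotient_isogeny P ℓ)
    (hcard : ∀ P : AbelianVariety K, P.natCard_torsionPoints_of_isAlgClosed (AlgebraicClosure K)) :
    mem_span_range_tateModule_map_of_equivariant_of_finite W W' ℓ :=
  mem_span_range_tateModule_map_of_equivariant_of_finite_of_isogenous_fact (W := W) (W' := W') ℓ
    (isIsogenous_of_finite_iff_exists_tateModule_hom_ne_zero_of_named_facts' W W' ℓ hbridge hprod
      hfin hquot hcard)

/-! ## `T_ℓ` of a biproduct, transport along the bridge, and the frontier with three named facts -/

section Transport

open CategoryTheory.Limits Literature.NumberTheory.EllipticCurves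

variable {W W' ℓ}

/-- Freeness of `T_ℓ` transports along an additive isomorphism of the underlying groups:
`T_ℓ(e⁻¹)` and `T_ℓ(e)` are mutually inverse `ℤ_ℓ`-linear maps (functoriality of `T_ℓ`,
Silverman, *AEC*, III.§7). [folklore] -/
theorem module_free_tateModule_of_addEquiv {M N : Type u} [AddCommGroup M] [AddCommGroup N]
    (e : M ≃+ N) [Module.Free ℤ_[ℓ] (TateModule N ℓ)] : Module.Free ℤ_[ℓ] (TateModule M ℓ) :=
  Module.Free.of_equiv
    (LinearEquiv.ofLinear (TateModule.map ℓ (e.symm : N →+ M)) (TateModule.map ℓ (e : M →+ N))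
      (tateModule_map_symm_comp ℓ e) (tateModule_map_comp_symm ℓ e))

/-- Finite generation of `T_ℓ` transports along an additive isomorphism of the underlying
groups (functoriality of `T_ℓ`, Silverman, *AEC*, III.§7). [folklore] -/
theorem module_finite_tateModule_of_addEquiv {M N : Type u} [AddCommGroup M] [AddCommGroup N]
    (e : M ≃+ N) [Module.Finite ℤ_[ℓ] (TateModule N ℓ)] : Module.Finite ℤ_[ℓ] (TateModule M ℓ) :=
  Module.Finite.equiv
    (LinearEquiv.ofLinear (TateModule.map ℓ (e.symm : N →+ M)) (TateModule.map ℓ (e : M →+ N))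
      (tateModule_map_symm_comp ℓ e) (tateModule_map_comp_symm ℓ e))

variable (ℓ) {A A' : AbelianVariety K}

/-- **`T_ℓ` of a biproduct of abelian varieties.** For a binary bicone `b` on `(A, A')` with
the total identity `fst ≫ inl + snd ≫ inr = 𝟙`, the map `x ↦ (T_ℓ(fst) x, T_ℓ(snd) x)` is a
`ℤ_ℓ`-linear isomorphism `T_ℓ(b.pt) ≅ T_ℓ A × T_ℓ A'` with inverse
`(y, z) ↦ T_ℓ(inl) y + T_ℓ(inr) z` — additivity and functoriality of `T_ℓ` (Mumford, *Abelian
Varieties*, §19: `T_ℓ(A × B) = T_ℓ A ⊕ T_ℓ B`). Stated as the existence of the linear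
equivalence. [folklore] -/
theorem AbelianVariety.exists_tateModule_linearEquiv_prod_of_bicone (b : BinaryBicone A A')
    (hb : b.fst ≫ b.inl + b.snd ≫ b.inr = 𝟙 b.pt) :
    Nonempty (b.pt.tateModule ℓ ≃ₗ[ℤ_[ℓ]] (A.tateModule ℓ × A'.tateModule ℓ)) := by
  have h1 : (tateModuleMap ℓ b.fst).comp (tateModuleMap ℓ b.inl) = LinearMap.id := by
    rw [← tateModuleMap_comp, b.inl_fst, tateModuleMap_id]
  have h2 : (tateModuleMap ℓ b.snd).comp (tateModuleMap ℓ b.inl) = 0 := by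
    rw [← tateModuleMap_comp, b.inl_snd, tateModuleMap_zero]
  have h3 : (tateModuleMap ℓ b.fst).comp (tateModuleMap ℓ b.inr) = 0 := by
    rw [← tateModuleMap_comp, b.inr_fst, tateModuleMap_zero]
  have h4 : (tateModuleMap ℓ b.snd).comp (tateModuleMap ℓ b.inr) = LinearMap.id := by
    rw [← tateModuleMap_comp, b.inr_snd, tateModuleMap_id]
  have h5 : (tateModuleMap ℓ b.inl).comp (tateModuleMap ℓ b.fst) +
      (tateModuleMap ℓ b.inr).comp (tateModuleMap ℓ b.snd) = LinearMap.id := by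
    rw [← tateModuleMap_comp, ← tateModuleMap_comp, ← tateModuleMap_add, hb, tateModuleMap_id]
  refine ⟨LinearEquiv.ofLinear ((tateModuleMap ℓ b.fst).prod (tateModuleMap ℓ b.snd))
    ((tateModuleMap ℓ b.inl).coprod (tateModuleMap ℓ b.inr)) ?_ ?_⟩
  · apply LinearMap.ext
    rintro ⟨y, z⟩
    have e1 := LinearMap.congr_fun h1 y
    have e2 := LinearMap.congr_fun h2 y
    have e3 := LinearMap.congr_fun h3 z
    have e4 := LinearMap.congr_fun h4 z
    simp only [LinearMap.comp_apply, LinearMap.id_apply, LinearMap.zero_apply] at e1 e2 e3 e4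
    refine Prod.ext ?_ ?_
    · show tateModuleMap ℓ b.fst (tateModuleMap ℓ b.inl y + tateModuleMap ℓ b.inr z) = y
      rw [map_add, e1, e3, add_zero]
    · show tateModuleMap ℓ b.snd (tateModuleMap ℓ b.inl y + tateModuleMap ℓ b.inr z) = z
      rw [map_add, e2, e4, zero_add]
  · apply LinearMap.ext
    intro x
    have e5 := LinearMap.congr_fun h5 x
    simp only [LinearMap.add_apply, LinearMap.comp_apply, LinearMap.id_apply] at e5
    exact e5

/-- `T_ℓ` of a biproduct vertex is free over `ℤ_ℓ` when `T_ℓ A` and `T_ℓ A'` are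
(`exists_tateModule_linearEquiv_prod_of_bicone`; Mumford §19). [folklore] -/
theorem AbelianVariety.module_free_tateModule_pt_of_bicone (b : BinaryBicone A A')
    (hb : b.fst ≫ b.inl + b.snd ≫ b.inr = 𝟙 b.pt)
    [Module.Free ℤ_[ℓ] (A.tateModule ℓ)] [Module.Free ℤ_[ℓ] (A'.tateModule ℓ)] :
    Module.Free ℤ_[ℓ] (b.pt.tateModule ℓ) := by
  obtain ⟨e⟩ := exists_tateModule_linearEquiv_prod_of_bicone ℓ b hb
  exact Module.Free.of_equiv e.symm

/-- `T_ℓ` of a biproduct vertex is finitely generated over `ℤ_ℓ` when `T_ℓ A` and `T_ℓ A'` are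
(`exists_tateModule_linearEquiv_prod_of_bicone`; Mumford §19). [folklore] -/
theorem AbelianVariety.module_finite_tateModule_pt_of_bicone (b : BinaryBicone A A')
    (hb : b.fst ≫ b.inl + b.snd ≫ b.inr = 𝟙 b.pt)
    [Module.Finite ℤ_[ℓ] (A.tateModule ℓ)] [Module.Finite ℤ_[ℓ] (A'.tateModule ℓ)] :
    Module.Finite ℤ_[ℓ] (b.pt.tateModule ℓ) := by
  obtain ⟨e⟩ := exists_tateModule_linearEquiv_prod_of_bicone ℓ b hb
  exact Module.Finite.equiv e.symm

variable (W W')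

/-- **Tate's isogeny theorem for elliptic curves over a finite field from three named facts**
(bridge, finiteness of isomorphism classes, quotient isogenies). Compared with
`isIsogenous_of_finite_iff_exists_tateModule_hom_ne_zero_of_named_facts'`, the biproduct of the
two bridged abelian varieties is the tree's instance (`AbelianVariety.hasBinaryBiproduct_inst`),
and the freeness and finite generation of `T_ℓ` of that biproduct — the only use of
`#P[n](K̄) = n^{2g}` in Tate's lattice argument (`tateSubspaceRealization_of_finite`) — come from
`T_ℓ E`, `T_ℓ E'` (Silverman, *AEC*, Prop. III.7.1, proved in the tree) through
`T_ℓ(b.pt) ≅ T_ℓ A × T_ℓ A'` and the bridge identifications `A(K̄) ≅ E(K̄)`, `A'(K̄) ≅ E'(K̄)`.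
What remains assumed: (1) `nonempty_abelianVarietyBridge_symm W W'` — elliptic curves over the
(perfect) finite field are one-dimensional abelian varieties whose homomorphisms are the
isogenies (*AEC* III.3.1(c), III.3.6, III.4.8–4.9); (3) `finite_isoClasses_of_finite K g` —
finitely many `K`-isomorphism classes of `g`-dimensional abelian varieties over the finite field
`K` (Milne 1986, Cor. 18.9; used for `g = dim (A × A')`); (4) `exists_quotient_isogeny P ℓ` —
quotients by finite `Γ_K`-stable `ℓ`-power subgroups with the factorisation of `[ℓⁿ]`
(Mumford §7 Thm. 4; Kieffer 2024, Prop. 1.1.10–1.1.13; used for `P = A × A'`). These are the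
inputs of Tate's printed proof for the abelian surface `E × E'` (Tate 1966, §2 and §3,
Theorem 1, proof of (b) ⇒ (a) via the Main Theorem for `A × B`). Tate, Invent. Math. 2 (1966),
Theorem 1 (b); Silverman, *AEC*, Thm. III.7.7(a). [cite: Tate1966Endomorphisms, Thm. 1(b)] -/
theorem isIsogenous_of_finite_iff_exists_tateModule_hom_ne_zero_of_bridge_of_finite_of_quotient
    (hbridge : nonempty_abelianVarietyBridge_symm W W')
    (hfin : ∀ g : ℕ, finite_isoClasses_of_finite K g)
    (hquot : ∀ P : AbelianVariety K, exists_quotient_isogeny P ℓ) :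
    isIsogenous_of_finite_iff_exists_tateModule_hom_ne_zero W W' ℓ := by
  intro _ _ _ hℓ
  haveI : PerfectField K := PerfectField.ofFinite
  obtain ⟨B, hB⟩ := hbridge
  obtain ⟨b, hb⟩ := exists_binaryBicone_total B.A B.A' (hasBinaryBiproduct_inst B.A B.A')
  haveI : Module.Free ℤ_[ℓ] (W.tateModule ℓ) := module_free_tateModule_holds W ℓ
  haveI : Module.Free ℤ_[ℓ] (W'.tateModule ℓ) := module_free_tateModule_holds W' ℓ
  haveI : Module.Finite ℤ_[ℓ] (W.tateModule ℓ) := module_finite_tateModule_holds W ℓ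
  haveI : Module.Finite ℤ_[ℓ] (W'.tateModule ℓ) := module_finite_tateModule_holds W' ℓ
  haveI : Module.Free ℤ_[ℓ] (B.A.tateModule ℓ) := module_free_tateModule_of_addEquiv B.e
  haveI : Module.Free ℤ_[ℓ] (B.A'.tateModule ℓ) := module_free_tateModule_of_addEquiv B.e'
  haveI : Module.Finite ℤ_[ℓ] (B.A.tateModule ℓ) := module_finite_tateModule_of_addEquiv B.e
  haveI : Module.Finite ℤ_[ℓ] (B.A'.tateModule ℓ) := module_finite_tateModule_of_addEquiv B.e'
  have hfree : module_free_tateModule b.pt ℓ := fun _ ↦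
    module_free_tateModule_pt_of_bicone ℓ b hb
  have hfinT : module_finite_tateModule b.pt ℓ :=
    module_finite_tateModule_pt_of_bicone ℓ b hb
  exact isIsogenous_of_finite_iff_exists_tateModule_hom_ne_zero_of_tateSubspaceRealization W W' ℓ
    b hb
    (fun {_} hℓ' ↦ tateSubspaceRealization_of_finite b.pt ℓ hℓ' (hfin _)
      (exists_isogeny_range_tateModuleMap_eq_of_quotient b.pt ℓ (hquot _))
      (fun _ ↦ dim_eq_of_isIsogenous_holds) hfree hfinT)
    B.e B.e_smul B.e' B.e'_smul
    (fun f hf ↦ isIsogenous_of_exists_isogeny_comp B.exists_isogeny f hf)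
    (fun f hf ↦ by
      obtain ⟨ψ, -⟩ := hB f hf
      exact ⟨ψ⟩)
    (Isogeny.nonempty_symm_holds_of_finite W' W) hℓ

/-- **Tate's Main Theorem (`Hom` form) for two elliptic curves over a finite field from three
named facts** — the current shape of the eventual
`mem_span_range_tateModule_map_of_equivariant_of_finite_holds`: granted the bridge
`nonempty_abelianVarietyBridge_symm W W'`, the finiteness of isomorphism classes of abelian
varieties of each dimension over the finite field (`finite_isoClasses_of_finite K g`, Milne 1986
Cor. 18.9) and quotient isogenies (`exists_quotient_isogeny P ℓ`, Mumford §7 Thm. 4), every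
`ℤ_ℓ`-linear `Γ_k`-equivariant `T_ℓ E → T_ℓ E'` (`E, E'` elliptic over the finite field `k`,
`ℓ ≠ char k`) lies in the `ℤ_ℓ`-span of the `T_ℓ φ`, `φ : E → E'` an isogeny over `k`. The three
facts give the isogeny theorem
(`isIsogenous_of_finite_iff_exists_tateModule_hom_ne_zero_of_bridge_of_finite_of_quotient`), and
the fact for isogenous pairs is the tree's theorem
`mem_span_range_tateModule_map_of_equivariant_of_finite_of_isIsogenous` (through
`…_of_isogenous_fact`). Tate, Invent. Math. 2 (1966), Main Theorem; Silverman, *AEC*,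
Thm. III.7.7(a). [cite: Tate1966Endomorphisms, Main Theorem] -/
theorem mem_span_range_tateModule_map_of_equivariant_of_finite_of_bridge_of_finite_of_quotient
    (hbridge : nonempty_abelianVarietyBridge_symm W W')
    (hfin : ∀ g : ℕ, finite_isoClasses_of_finite K g)
    (hquot : ∀ P : AbelianVariety K, exists_quotient_isogeny P ℓ) :
    mem_span_range_tateModule_map_of_equivariant_of_finite W W' ℓ :=
  mem_span_range_tateModule_map_of_equivariant_of_finite_of_isogenous_fact (W := W) (W' := W') ℓ
    (isIsogenous_of_finite_iff_exists_tateModule_hom_ne_zero_of_bridge_of_finite_of_quotient W W' ℓ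
      hbridge hfin hquot)

end Transport

/-! ## The frontier with two named facts

The bridge `nonempty_abelianVarietyBridge_symm W W'` is discharged in the tree
(`WeierstrassCurve.nonempty_abelianVarietyBridge_symm_holds`, `EllipticCurves/AbelianVarietyBridgeProofs`,
from the plane-cubic model `E_W ⊂ ℙ²_K` of `EllipticCurves/WeierstrassScheme` with its group law),
so Tate's theorem for two elliptic curves over a finite field now rests on two named facts of the
theory of abelian varieties over `K`, used for the abelian surface `A ⊞ A' ≅ E × E'` exactly as in
Tate's printed proof (Invent. Math. 2 (1966), §2 and §3 Theorem 1, (b) ⇒ (a) through the Main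
Theorem for `A × B`):

* `AbelianVariety.finite_isoClasses_of_finite K g` (all `g`; used at `g = dim (A ⊞ A')`): finitely
  many `K`-isomorphism classes of `g`-dimensional abelian varieties over the finite field `K`
  (Milne 1986, Cor. 18.9; in Tate's text, finiteness of polarised abelian varieties of given degree
  over a finite field);
* `AbelianVariety.exists_quotient_isogeny P ℓ` (all `P`; used at `P = A ⊞ A'`): the quotient of `P`
  by a finite `Γ_K`-stable `ℓ`-power subgroup of `P(K̄)` with the factorisation of `[ℓⁿ]` through it
  (Mumford, *Abelian Varieties*, §7 Thm. 4; Kieffer 2024, Prop. 1.1.10–1.1.13).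
-/

section TwoFacts

/-- **Tate's isogeny theorem for elliptic curves over a finite field from two named facts**
(finiteness of isomorphism classes over the finite field, quotient isogenies): for `k` finite,
`E, E'` elliptic over `k` and `ℓ ≠ char k`, `E ~_k E'` iff there is a non-zero `Γ_k`-equivariant
`ℤ_ℓ`-linear map `T_ℓ E → T_ℓ E'` — the named fact
`isIsogenous_of_finite_iff_exists_tateModule_hom_ne_zero W W' ℓ` — granted
`finite_isoClasses_of_finite K g` for all `g` and `exists_quotient_isogeny P ℓ` for all abelian
varieties `P` over `K`. This is
`isIsogenous_of_finite_iff_exists_tateModule_hom_ne_zero_of_bridge_of_finite_of_quotient` with its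
bridge hypothesis fed by the tree's theorem `WeierstrassCurve.nonempty_abelianVarietyBridge_symm_holds`
(elliptic curves over the perfect field `k` are one-dimensional abelian varieties whose non-zero
homomorphisms are the isogenies; Silverman, *AEC* III.3.6, III.4.8). Tate, Invent. Math. 2 (1966),
§3 Theorem 1 (b) ⇒ (a); Silverman, *AEC*, Thm. III.7.7(a). [cite: Tate1966Endomorphisms, Thm. 1(b)] -/
theorem isIsogenous_of_finite_iff_exists_tateModule_hom_ne_zero_of_finite_of_quotient
    (hfin : ∀ g : ℕ, finite_isoClasses_of_finite K g)
    (hquot : ∀ P : AbelianVariety K, exists_quotient_isogeny P ℓ) :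
    isIsogenous_of_finite_iff_exists_tateModule_hom_ne_zero W W' ℓ :=
  isIsogenous_of_finite_iff_exists_tateModule_hom_ne_zero_of_bridge_of_finite_of_quotient W W' ℓ
    (nonempty_abelianVarietyBridge_symm_holds W W') hfin hquot

/-- **Tate's Main Theorem (`Hom` form) for two elliptic curves over a finite field from two named
facts** — the current shape of the eventual
`mem_span_range_tateModule_map_of_equivariant_of_finite_holds`: granted the finiteness of
isomorphism classes of abelian varieties of each dimension over the finite field
(`finite_isoClasses_of_finite K g`, Milne 1986 Cor. 18.9) and quotient isogenies
(`exists_quotient_isogeny P ℓ`, Mumford §7 Thm. 4), every `ℤ_ℓ`-linear `Γ_k`-equivariant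
`T_ℓ E → T_ℓ E'` (`E, E'` elliptic over the finite field `k`, `ℓ ≠ char k`) lies in the `ℤ_ℓ`-span
of the `T_ℓ φ`, `φ : E → E'` an isogeny over `k` (surjectivity of
`Hom_k(E, E') ⊗ ℤ_ℓ → Hom_{Γ_k}(T_ℓ E, T_ℓ E')`). The bridge hypothesis of
`mem_span_range_tateModule_map_of_equivariant_of_finite_of_bridge_of_finite_of_quotient` is the
tree's theorem `WeierstrassCurve.nonempty_abelianVarietyBridge_symm_holds`. Tate, Invent. Math. 2
(1966), Main Theorem; Silverman, *AEC*, Thm. III.7.7(a). [cite: Tate1966Endomorphisms, Main Theorem] -/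
theorem mem_span_range_tateModule_map_of_equivariant_of_finite_of_finite_of_quotient
    (hfin : ∀ g : ℕ, finite_isoClasses_of_finite K g)
    (hquot : ∀ P : AbelianVariety K, exists_quotient_isogeny P ℓ) :
    mem_span_range_tateModule_map_of_equivariant_of_finite W W' ℓ :=
  mem_span_range_tateModule_map_of_equivariant_of_finite_of_bridge_of_finite_of_quotient W W' ℓ
    (nonempty_abelianVarietyBridge_symm_holds W W') hfin hquot

end TwoFacts

/-! ## The frontier with one named fact

The quotient fact `exists_quotient_isogeny P ℓ` is discharged in the tree
(`AbelianVariety.exists_quotient_isogeny_holds`, `Motives/TateAbelianFiniteLatticeProofs`: the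
quotient of an abelian variety over a perfect field by a finite `Γ_K`-stable subgroup of its
geometric points, `AbelianVarietyQuotientGeomPoints`, with Kieffer's factorisation of `[ℓⁿ]`
through it, Prop. 1.1.12–1.1.13; Mumford, *Abelian Varieties*, §7 Thm. 4), so Tate's theorem for
two elliptic curves over a finite field now rests on a single named fact of the theory of abelian
varieties over the finite field `K`:

* `AbelianVariety.finite_isoClasses_of_finite K g` (all `g`; used only at `g = dim (A ⊞ A')` for
  the abelian surface `A ⊞ A' ≅ E × E'` of Tate's printed proof): finitely many `K`-isomorphism
  classes of `g`-dimensional abelian varieties over the finite field `K` (Milne 1986, Cor. 18.9;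
  Tate 1966, §2, the hypothesis of finiteness, verified over finite fields from the finiteness of
  polarised abelian varieties of given degree and dimension).

What the lattice argument consumes of it is only **(∞-iso)** for the surface `A ⊞ A'`: in every
sequence of abelian varieties over `K` isogenous to `A ⊞ A'` infinitely many terms are mutually
isomorphic (finiteness of `K`-isomorphism classes within the isogeny class; Milne, *Abelian
Varieties* (2008), Ch. IV, Lemma 2.4). The last two theorems record the isogeny theorem and the
`Hom` form of the Main Theorem from (∞-iso) for all abelian varieties over the finite field, through
the tree's perfect-field lattice lemma `tateSubspaceRealization_of_exists_infinite_iso`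
(`TateAbelianLatticeOfFinitenessProofs`) in place of `tateSubspaceRealization_of_finite`.
-/

section OneFact

/-- **Tate's isogeny theorem for elliptic curves over a finite field from one named fact**
(finiteness of isomorphism classes of abelian varieties of each dimension over the finite field):
for `k` finite, `E, E'` elliptic over `k` and `ℓ ≠ char k`, `E ~_k E'` iff there is a non-zero
`Γ_k`-equivariant `ℤ_ℓ`-linear map `T_ℓ E → T_ℓ E'` — the named fact
`isIsogenous_of_finite_iff_exists_tateModule_hom_ne_zero W W' ℓ` — granted
`finite_isoClasses_of_finite K g` for all `g`. This is
`isIsogenous_of_finite_iff_exists_tateModule_hom_ne_zero_of_finite_of_quotient` with its quotient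
hypothesis fed by the tree's theorem `AbelianVariety.exists_quotient_isogeny_holds` (quotients of
abelian varieties by finite `Γ_k`-stable `ℓ`-power subgroups with the factorisation of `[ℓⁿ]`;
Mumford §7 Thm. 4, Kieffer 2024 Prop. 1.1.10–1.1.13). Tate, Invent. Math. 2 (1966), §3
Theorem 1 (b) ⇒ (a); Silverman, *AEC*, Thm. III.7.7(a). [cite: Tate1966Endomorphisms, Thm. 1(b)] -/
theorem isIsogenous_of_finite_iff_exists_tateModule_hom_ne_zero_of_finite_isoClasses
    (hfin : ∀ g : ℕ, finite_isoClasses_of_finite K g) :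
    isIsogenous_of_finite_iff_exists_tateModule_hom_ne_zero W W' ℓ :=
  isIsogenous_of_finite_iff_exists_tateModule_hom_ne_zero_of_finite_of_quotient W W' ℓ hfin
    fun P ↦ exists_quotient_isogeny_holds P ℓ

/-- **Tate's Main Theorem (`Hom` form) for two elliptic curves over a finite field from one named
fact** — the current shape of the eventual
`mem_span_range_tateModule_map_of_equivariant_of_finite_holds`: granted the finiteness of
isomorphism classes of abelian varieties of each dimension over the finite field
(`finite_isoClasses_of_finite K g`, Milne 1986 Cor. 18.9), every `ℤ_ℓ`-linear `Γ_k`-equivariant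
`T_ℓ E → T_ℓ E'` (`E, E'` elliptic over the finite field `k`, `ℓ ≠ char k`) lies in the `ℤ_ℓ`-span
of the `T_ℓ φ`, `φ : E → E'` an isogeny over `k` (surjectivity of
`Hom_k(E, E') ⊗ ℤ_ℓ → Hom_{Γ_k}(T_ℓ E, T_ℓ E')`). The quotient hypothesis of
`mem_span_range_tateModule_map_of_equivariant_of_finite_of_finite_of_quotient` is the tree's
theorem `AbelianVariety.exists_quotient_isogeny_holds`. Tate, Invent. Math. 2 (1966), Main
Theorem; Silverman, *AEC*, Thm. III.7.7(a). [cite: Tate1966Endomorphisms, Main Theorem] -/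
theorem mem_span_range_tateModule_map_of_equivariant_of_finite_of_finite_isoClasses
    (hfin : ∀ g : ℕ, finite_isoClasses_of_finite K g) :
    mem_span_range_tateModule_map_of_equivariant_of_finite W W' ℓ :=
  mem_span_range_tateModule_map_of_equivariant_of_finite_of_finite_of_quotient W W' ℓ hfin
    fun P ↦ exists_quotient_isogeny_holds P ℓ

/-! ### From finiteness within isogeny classes, (∞-iso) -/

open CategoryTheory.Limits Literature.NumberTheory.EllipticCurves in
/-- **Tate's isogeny theorem for elliptic curves over a finite field from (∞-iso)** — the
hypothesis actually consumed by Tate's lattice argument: granted that in every sequence of abelian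
varieties over the finite field `K` isogenous to a given one infinitely many terms are mutually
isomorphic (`hiso`; finiteness of `K`-isomorphism classes within each isogeny class — Tate 1966,
§2, the finiteness hypothesis as used; Milne, *Abelian Varieties* (2008), Ch. IV, Lemma 2.4), for `E, E'`
elliptic over `K` and `ℓ ≠ char K`, `E ~_K E'` iff there is a non-zero `Γ_K`-equivariant
`ℤ_ℓ`-linear map `T_ℓ E → T_ℓ E'`. The proof is that of
`isIsogenous_of_finite_iff_exists_tateModule_hom_ne_zero_of_bridge_of_finite_of_quotient` with the
bridge `nonempty_abelianVarietyBridge_symm_holds W W'`, the biproduct `b` of the two bridged abelian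
varieties, `T_ℓ(b.pt)` free of finite rank from `T_ℓ E`, `T_ℓ E'` (Silverman, *AEC*, III.7.1),
the quotient dictionary fed by `AbelianVariety.exists_quotient_isogeny_holds b.pt ℓ`, and the
perfect-field lattice lemma `tateSubspaceRealization_of_exists_infinite_iso b.pt ℓ` applied to
`hiso b.pt`. Tate, Invent. Math. 2 (1966), §2 and §3 Theorem 1 (b) ⇒ (a); Silverman, *AEC*,
Thm. III.7.7(a). [cite: Tate1966Endomorphisms, Thm. 1(b)] -/
theorem isIsogenous_of_finite_iff_exists_tateModule_hom_ne_zero_of_exists_infinite_iso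
    (hiso : ∀ [Finite K] (P : AbelianVariety K) (C : ℕ → AbelianVariety K),
      (∀ n, IsIsogenous (C n) P) → ∃ S : Set ℕ, S.Infinite ∧ ∀ m ∈ S, ∀ n ∈ S, Nonempty (C m ≅ C n)) :
    isIsogenous_of_finite_iff_exists_tateModule_hom_ne_zero W W' ℓ := by
  intro _ _ _ hℓ
  haveI : PerfectField K := PerfectField.ofFinite
  obtain ⟨B, hB⟩ := nonempty_abelianVarietyBridge_symm_holds W W'
  obtain ⟨b, hb⟩ := exists_binaryBicone_total B.A B.A' (hasBinaryBiproduct_inst B.A B.A')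
  haveI : Module.Free ℤ_[ℓ] (W.tateModule ℓ) := module_free_tateModule_holds W ℓ
  haveI : Module.Free ℤ_[ℓ] (W'.tateModule ℓ) := module_free_tateModule_holds W' ℓ
  haveI : Module.Finite ℤ_[ℓ] (W.tateModule ℓ) := module_finite_tateModule_holds W ℓ
  haveI : Module.Finite ℤ_[ℓ] (W'.tateModule ℓ) := module_finite_tateModule_holds W' ℓ
  haveI : Module.Free ℤ_[ℓ] (B.A.tateModule ℓ) := module_free_tateModule_of_addEquiv B.e
  haveI : Module.Free ℤ_[ℓ] (B.A'.tateModule ℓ) := module_free_tateModule_of_addEquiv B.e'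
  haveI : Module.Finite ℤ_[ℓ] (B.A.tateModule ℓ) := module_finite_tateModule_of_addEquiv B.e
  haveI : Module.Finite ℤ_[ℓ] (B.A'.tateModule ℓ) := module_finite_tateModule_of_addEquiv B.e'
  have hfree : module_free_tateModule b.pt ℓ := fun _ ↦
    module_free_tateModule_pt_of_bicone ℓ b hb
  have hfinT : module_finite_tateModule b.pt ℓ :=
    module_finite_tateModule_pt_of_bicone ℓ b hb
  exact isIsogenous_of_finite_iff_exists_tateModule_hom_ne_zero_of_tateSubspaceRealization W W' ℓ
    b hb
    (fun {_} hℓ' ↦ tateSubspaceRealization_of_exists_infinite_iso b.pt ℓ hℓ' (hiso b.pt)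
      (exists_isogeny_range_tateModuleMap_eq_of_quotient b.pt ℓ (exists_quotient_isogeny_holds b.pt ℓ))
      hfree hfinT)
    B.e B.e_smul B.e' B.e'_smul
    (fun f hf ↦ isIsogenous_of_exists_isogeny_comp B.exists_isogeny f hf)
    (fun f hf ↦ by
      obtain ⟨ψ, -⟩ := hB f hf
      exact ⟨ψ⟩)
    (Isogeny.nonempty_symm_holds_of_finite W' W) hℓ

/-- **Tate's Main Theorem (`Hom` form) for two elliptic curves over a finite field from (∞-iso)**:
granted that in every sequence of abelian varieties over the finite field `K` isogenous to a given
one infinitely many terms are mutually isomorphic (`hiso`; Tate 1966, §2; Milne, *Abelian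
Varieties* (2008), Ch. IV, Lemma 2.4), every `ℤ_ℓ`-linear `Γ_K`-equivariant `T_ℓ E → T_ℓ E'`
(`E, E'` elliptic over `K`, `ℓ ≠ char K`) lies in the `ℤ_ℓ`-span of the `T_ℓ φ`, `φ : E → E'` an
isogeny over `K` — from the isogeny theorem
`isIsogenous_of_finite_iff_exists_tateModule_hom_ne_zero_of_exists_infinite_iso` and the tree's
theorem for isogenous pairs (`…_of_isogenous_fact`). Tate, Invent. Math. 2 (1966), Main Theorem;
Silverman, *AEC*, Thm. III.7.7(a). [cite: Tate1966Endomorphisms, Main Theorem] -/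
theorem mem_span_range_tateModule_map_of_equivariant_of_finite_of_exists_infinite_iso
    (hiso : ∀ [Finite K] (P : AbelianVariety K) (C : ℕ → AbelianVariety K),
      (∀ n, IsIsogenous (C n) P) → ∃ S : Set ℕ, S.Infinite ∧ ∀ m ∈ S, ∀ n ∈ S, Nonempty (C m ≅ C n)) :
    mem_span_range_tateModule_map_of_equivariant_of_finite W W' ℓ :=
  mem_span_range_tateModule_map_of_equivariant_of_finite_of_isogenous_fact (W := W) (W' := W') ℓ
    (isIsogenous_of_finite_iff_exists_tateModule_hom_ne_zero_of_exists_infinite_iso W W' ℓ hiso)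

end OneFact

end Literature.AlgebraicGeometry.Motives
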